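import Mathlib
import HarnessLib
import Summits.HubbardSuperconductivity.HubbardSuperconductivity.Theorems.KLProgrammeKLRegimeEngineV8IsoTupleExport
import Summits.HubbardSuperconductivity.HubbardSuperconductivity.Theorems.KLProgrammeKLRegimeEngineV8DefsU10
import Summits.HubbardSuperconductivity.HubbardSuperconductivity.Theorems.KLProgrammeKLRegimeEngineV8DefsL4
import Summits.HubbardSuperconductivity.HubbardSuperconductivity.Theorems.KLProgrammeKLRegimeEngineKernelNormsWt4
import Summits.HubbardSuperconductivity.HubbardSuperconductivity.Theorems.KLProgrammeKLRegimeEngineWtBudget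

/-!
# Route `KLProgramme` — ENGINE child gen 8 (stmt-HubbardSuperconductivity-20437 `KLRegimeEngineV17F2`), SKELETON v2 class #6, SUCCESSOR MODULE of
# `…EngineV8IsoTupleExport` (plan g17 (R47i″) (W-a) inputs; plan g19 (R57)/(R57d)(ii) parameter-Q; (R59e) word of record; (R59f)(i) filing ruling «(α)-shape»;
# gate fact `theorems.append-only`; cell gate-hubbard-kl, seat hubbard-kl-k3c2-p2 g9 = class-#6 text owner)

NAME MAP (old ↦ new): `IsoTupleLineStep ↦ IsoTupleLineStepW` · `IsIsoPkg ↦ IsIsoPkgW` · `klIsoPkg ↦ klIsoPkgW` · `klE5a/klE5b/klE5u ↦ klE5aW/klE5bW/klE5uW`.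
The landed module stays (`IsoTupleLineAt`, `IsoTupleLineAt.mono`, the door `isoTupleL1AtV17F_of_isoTupleLineAt_hist` are imported and reused; nothing there is edited).

WHAT CHANGES AND WHY.
* §1 **`IsIsoPkgW P CF e`** — admissibility with the FIT stated against a CF PARAMETER `CF : ℝ` ((R59f): neutral to E1's question (7); at the composition
  `CF := klEngGeo8.CF`, or the raised table's `CF` under the contingent token #22).
* §2 **`IsoTupleLineStepW P R Q a b u`** — parameter-Q ((R57d)(ii): the producer input (W) has the `Q.CE`-keyed budget `klWtBudget P Q U j 4 = Q.CE²·ε_j·2^j`, so the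
  package may depend on the TABLE package `Q` = token #13; the history is read at that `Q`, no `IsRaiseOf` binder; `∀ G, G.WF →` kept, G read only through the history);
  inputs per (R47i″) (W-a): `hwt : ∀ j ≤ n, KernelNormsWt4 L M (klWtBudget P Q U j) β U μ (K_n) j` (at `j = n` this is stub (b)ₙ's own conjunct at `K_n` — a scale-n read,
  declared (R59e)(i); the composition interleaves `(b)ₙ → iso(n) → (c)ₙ`, (R59e)(ii)) and `hiso : ∀ j < n, IsoTupleLineAt … j`; `LevelsUExportAt` dropped; doors
  `U ≤ klEngU₀10 P R cc` (#14), the step's own `U ≤ u cc`, `klEngL₄ P R β U ≤ L` (#16), `klEngM₃`.  The predicate `IsoTupleLineAt` is UNCHANGED (U-linear); its producer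
  question is the booked located constraint «(c)-E5-SECULAR» ((R59e)(8)), not prejudged by this consumer-side text.
* §3 the successor deferred package **`klIsoPkgW P R Q CF`** (dite over the (X).2 condition of record `∃ e, IsIsoPkgW P CF e ∧ IsoTupleLineStepW P R Q e.1 e.2.1 e.2.2`, else
  `(0, 0, 1)`), projections `klE5aW/klE5bW/klE5uW`, unconditional rows (`0 ≤ CF`): `isIsoPkgW_klIsoPkgW`, `klE5aW_nonneg`, `klE5bW_nonneg`, `klE5uW_pos`, `klE5W_fit(_of_le)`,
  and the `choose_spec` rows `isoTupleLineStepW_klE5W_of_exists/_of`.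
CONSUMERS: stub (X).2 (the dite condition verbatim at `Q := klEngQ9 P R`, `CF := <G>.CF`), stub (c) v2x `hiso : ∀ j ≤ n, IsoTupleLineAt L M (klE5aW …) (klE5bW …) P β U μ j` +
`klE5W_fit_of_le` for the door's constant condition, DefsU11 (`klEngU₀11 ≤ klE5uW P R (QT P R) CF cc`).

Definitions with bodies + bookkeeping; nothing about the model is asserted; nothing asserts superconductivity.
-/

noncomputable section

namespace Summit.HubbardSuperconductivity.HubbardSuperconductivity.Theorems.KLRegimeSplit

set_option linter.dupNamespace false -- summit = problem name (single-conjunct summit), D-0017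

open Real Finset Literature.MathematicalPhysics.QuantumLattice Literature.Probability.LatticeModels
open Summit.HubbardSuperconductivity.HubbardSuperconductivity.Theorems.KLProgrammeLegKernels
open Summit.HubbardSuperconductivity.HubbardSuperconductivity.Theorems.DispersionFlow
open Summit.HubbardSuperconductivity.HubbardSuperconductivity.Theorems.EngineV8


/-! ## §1 Admissible packages (fit against a CF parameter) -/

/-- **`IsIsoPkgW P CF (a, b, u)`**: `0 ≤ a`, `0 ≤ b`, and for every regime constant `cc` the threshold `u cc` is positive and FITS: `a + b·Klam²·(u cc) ≤ CF/2`. -/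
def IsIsoPkgW (P : SplitConsts) (CF : ℝ) (e : ℝ × ℝ × (ℝ → ℝ)) : Prop :=
  0 ≤ e.1 ∧ 0 ≤ e.2.1 ∧ ∀ cc : ℝ, 0 < e.2.2 cc ∧ e.1 + e.2.1 * P.Klam ^ 2 * e.2.2 cc ≤ CF / 2

/-- The trivial package `(0, 0, 1)` is admissible for every `CF ≥ 0`. -/
theorem isIsoPkgW_zero (P : SplitConsts) {CF : ℝ} (hCF : 0 ≤ CF) : IsIsoPkgW P CF (0, 0, fun _ => 1) := by
  refine ⟨le_rfl, le_rfl, fun cc => ⟨one_pos, ?_⟩⟩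
  simp only [zero_mul, add_zero]
  linarith

/-! ## §2 The successor step (parameter-Q, (W-a) inputs) -/

/-- **`IsoTupleLineStepW P R Q a b u`** — class #6 successor step: for every geometry package `G` (`G.WF`; read only through the history), at the TABLE package `Q`
(parameter-Q), under the v2 stub binders (`klEngC₃6`, `klEngU₀10`, the step's own threshold `u cc`, `klEngL₄ P R`, `klEngM₃`; `n ≤ nScales β + 1`, `IsKLRegime`), the history
at `G P Q R`, the admissibility of `K_n`, the WEIGHTED quartic data at every `j ≤ n` at frame `K_n` ((R47i″) (W-a): stub (b)ₙ's own conjunct at `j = n`) and the iso lines at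
every `j < n` give the iso line at `n`. -/
def IsoTupleLineStepW (P : SplitConsts) (R : RenConsts) (Q : EngConsts) (a b : ℝ) (u : ℝ → ℝ) : Prop :=
  ∀ G : GeoConsts, G.WF →
    ∀ cc : ℝ, 0 < cc → cc ≤ klEngC₃6 P R →
      ∀ μ ∈ klWindowC, ∀ U : ℝ, 0 < U → U ≤ klEngU₀10 P R cc → U ≤ u cc →
        ∀ β : ℝ, klBetaMin ≤ β → β ≤ Real.exp (cc / U ^ 2) →
          ∀ (L M : ℕ) [NeZero L] [NeZero M], klEngL₄ P R β U ≤ L → klEngM₃ β U L ≤ M →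
            ∀ n : ℕ, n ≤ nScales β + 1 → IsKLRegime U cc (-(n : ℤ)) →
              HistP klPredsV17F2 L M G P Q R β U μ 0 n →
                FrameOK R U (nScales β) μ (klFlowFrameU L M β U μ n) →
                  (∀ j ≤ n, KernelNormsWt4 L M (klWtBudget P Q U j) β U μ (klFlowFrameU L M β U μ n) j) →
                    (∀ j < n, IsoTupleLineAt L M a b P β U μ j) →
                      IsoTupleLineAt L M a b P β U μ n

/-! ## §3 The successor deferred package (4 keys + the CF parameter) -/

section Deferred

variable (P : SplitConsts) (R : RenConsts) (Q : EngConsts) (CF : ℝ)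

/-- The successor deferred class-#6 package: SOME admissible `(a, b, u)` for which the step holds, else `(0, 0, 1)`. -/
def klIsoPkgW : ℝ × ℝ × (ℝ → ℝ) :=
  open scoped Classical in
  if h : ∃ e : ℝ × ℝ × (ℝ → ℝ), IsIsoPkgW P CF e ∧ IsoTupleLineStepW P R Q e.1 e.2.1 e.2.2 then Classical.choose h else (0, 0, fun _ => 1)

/-- **`klE5aW`** — the deferred U-linear constant. -/
def klE5aW : ℝ := (klIsoPkgW P R Q CF).1
/-- **`klE5bW`** — the deferred quadratic constant. -/
def klE5bW : ℝ := (klIsoPkgW P R Q CF).2.1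
/-- **`klE5uW`** — the deferred threshold (a DefsU11 `min` term: `klE5uW P R (QT P R) CF cc`). -/
def klE5uW : ℝ → ℝ := (klIsoPkgW P R Q CF).2.2

/-- The deferred package is admissible whenever `0 ≤ CF`. -/
theorem isIsoPkgW_klIsoPkgW (hCF : 0 ≤ CF) : IsIsoPkgW P CF (klIsoPkgW P R Q CF) := by
  classical
  unfold klIsoPkgW
  split_ifs with h
  · exact (Classical.choose_spec h).1
  · exact isIsoPkgW_zero P hCF

/-- `0 ≤ klE5aW` (`0 ≤ CF`). -/
theorem klE5aW_nonneg (hCF : 0 ≤ CF) : 0 ≤ klE5aW P R Q CF := (isIsoPkgW_klIsoPkgW P R Q CF hCF).1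
/-- `0 ≤ klE5bW` (`0 ≤ CF`). -/
theorem klE5bW_nonneg (hCF : 0 ≤ CF) : 0 ≤ klE5bW P R Q CF := (isIsoPkgW_klIsoPkgW P R Q CF hCF).2.1
/-- **`0 < klE5uW cc`** (`0 ≤ CF`). -/
theorem klE5uW_pos (hCF : 0 ≤ CF) (cc : ℝ) : 0 < klE5uW P R Q CF cc := ((isIsoPkgW_klIsoPkgW P R Q CF hCF).2.2 cc).1
/-- **The FIT at the threshold**: `klE5aW + klE5bW·Klam²·(klE5uW cc) ≤ CF/2` (`0 ≤ CF`). -/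
theorem klE5W_fit (hCF : 0 ≤ CF) (cc : ℝ) : klE5aW P R Q CF + klE5bW P R Q CF * P.Klam ^ 2 * klE5uW P R Q CF cc ≤ CF / 2 :=
  ((isIsoPkgW_klIsoPkgW P R Q CF hCF).2.2 cc).2

/-- **The door's constant condition below the threshold**: `0 ≤ U ≤ klE5uW cc ⟹ klE5aW + klE5bW·Klam²·U ≤ CF/2`. -/
theorem klE5W_fit_of_le (hCF : 0 ≤ CF) {cc U : ℝ} (hU : U ≤ klE5uW P R Q CF cc) :
    klE5aW P R Q CF + klE5bW P R Q CF * P.Klam ^ 2 * U ≤ CF / 2 := by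
  have hb : 0 ≤ klE5bW P R Q CF * P.Klam ^ 2 := mul_nonneg (klE5bW_nonneg P R Q CF hCF) (sq_nonneg _)
  have h1 := mul_le_mul_of_nonneg_left hU hb
  linarith [klE5W_fit P R Q CF hCF cc]

variable {P R Q CF}

/-- **The step holds for the deferred package as soon as it holds for some admissible package** (the (X) conjunct's consumer). -/
theorem isoTupleLineStepW_klE5W_of_exists (h : ∃ e : ℝ × ℝ × (ℝ → ℝ), IsIsoPkgW P CF e ∧ IsoTupleLineStepW P R Q e.1 e.2.1 e.2.2) :
    IsoTupleLineStepW P R Q (klE5aW P R Q CF) (klE5bW P R Q CF) (klE5uW P R Q CF) := by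
  classical
  have hpkg : klIsoPkgW P R Q CF = Classical.choose h := by
    unfold klIsoPkgW
    rw [dif_pos h]
  unfold klE5aW klE5bW klE5uW
  rw [hpkg]
  exact (Classical.choose_spec h).2

/-- Packaging an explicit witness. -/
theorem isoTupleLineStepW_klE5W_of {a b : ℝ} {u : ℝ → ℝ} (ha : 0 ≤ a) (hb : 0 ≤ b) (hu : ∀ cc, 0 < u cc ∧ a + b * P.Klam ^ 2 * u cc ≤ CF / 2)
    (hs : IsoTupleLineStepW P R Q a b u) : IsoTupleLineStepW P R Q (klE5aW P R Q CF) (klE5bW P R Q CF) (klE5uW P R Q CF) :=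
  isoTupleLineStepW_klE5W_of_exists ⟨(a, b, u), ⟨ha, hb, hu⟩, hs⟩

end Deferred

end Summit.HubbardSuperconductivity.HubbardSuperconductivity.Theorems.KLRegimeSplit

end
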